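import Literature.AlgebraicGeometry.HodgeTheory.BettiUniverseTracePairing
import Literature.AlgebraicGeometry.HodgeTheory.TopDegreeClasses
import Literature.AlgebraicTopology.SingularHomology.DisjointCarriersCupPairing
import HarnessLib

/-!
# The trace form vanishes on classes whose Poincaré duals have disjoint carriers (Bredon VI.11.10 for `tr ∘ cup` on `X(ℂ)`)

Family `hodge`, layer `Literature/AlgebraicGeometry/HodgeTheory`; theorems only (no definition, no named fact). Written by the prover seat
`hodge-nonav-prover-Ax` (g18). G. E. Bredon, *Topology and Geometry* (1993), Ch. VI Thm. 11.10, PROVED in the tree for the cup pairing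
`⟨σ ∪ τ, [X]⟩` of a closed oriented manifold (`cupPairing_eq_zero_of_disjoint_carriers`, file `DisjointCarriersCupPairing`); here for the
light trace form `tr(a ∪ b)` of `BettiUniverseAxioms` on a smooth projective `X` (the top degree `H²ⁿ(X(ℂ); ℚ)` is detected by
`⟨·, [X(ℂ)]⟩`, Hatcher Thm. 3.26), with the carriers given as images `im(H_•(A_k) → H_•(X(ℂ)))` of subsets `A₁, A₂` with
`closure A₁ ∩ A₂ = ∅` — the orthogonality hypothesis `horth` of
`Summit…Theorems.Q8MonodromyBireflectionAssembly.monodromyBireflection_of_twoBallDatum` (crux K1Q stub S5,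
`Summits/HodgeConjecture/HodgeConjecture/Theses/Q8SymplecticPowers.lean`: the two balls of the d6 localisation have disjoint closures).

* `eq_zero_of_kroneckerPairing_fundamentalClass_eq_zero` — `⟨z, [X(ℂ)]⟩ = 0 ⇒ z = 0` on `H²ⁿ(X(ℂ); ℚ)`.
* **`tr_cup_eq_zero_of_disjoint_carriers`** (all degrees `k + l = 2n`), **`tr_cup_eq_zero_of_disjoint_carriers_two`** (surfaces, the
  literal `(n := 4)` currency of the K1Q assembly).

## References

* [Bredon1993] G. E. Bredon, Topology and Geometry, GTM 139, Springer 1993, Ch. VI Thm. 11.10.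
* [HatcherAT2002] A. Hatcher, Algebraic Topology, CUP 2002, §3.1 Thm. 3.2, §3.3 Thm. 3.26.
-/

noncomputable section

open CategoryTheory Set
open Literature.AlgebraicTopology.SingularHomology
open Literature.AlgebraicGeometry.Motives (bettiCohomology bettiCup IsSmoothProjective ComplexPoints)

namespace Literature.AlgebraicGeometry.HodgeTheory

namespace BettiUniverse

variable {n : ℕ} {X : Motives.SchemeOver ℂ}

/-- **`⟨z, [X(ℂ)]⟩ = 0 ⇒ z = 0` on `H²ⁿ(X(ℂ); ℚ)`**: `H₂ₙ(X(ℂ); ℚ) = ℚ · [X(ℂ)]` (Hatcher Thm. 3.26, `X(ℂ)` connected) and the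
Kronecker map is injective over a field (Thm. 3.2). [cite: HatcherAT2002, §3.3 Thm. 3.26 and §3.1 Thm. 3.2] -/
theorem eq_zero_of_kroneckerPairing_fundamentalClass_eq_zero (hX : IsSmoothProjective n X) (z : bettiCohomology X (2 * n))
    (hz : kroneckerPairing ℚ ℚ (ComplexPoints X) (2 * n) z (complexOrientationRat hX).fundamentalClass = 0) : z = 0 := by
  letI := hX.chartedSpace
  haveI := Motives.ComplexPoints.compactSpace_of_isSmoothProjective hX
  haveI := Motives.ComplexPoints.t2Space_of_isSmoothProjective hX
  haveI := connectedSpace_complexPoints hX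
  apply kroneckerPairing_injective_of_field ℚ (ComplexPoints X) (2 * n)
  refine LinearMap.ext fun c ↦ ?_
  obtain ⟨a, rfl⟩ := exists_eq_smul_fundamentalClass_of_connectedSpace (complexOrientationRat hX) c
  rw [map_smul, hz, smul_zero, map_zero, LinearMap.zero_apply]

/-- **The trace form vanishes on classes with disjointly carried Poincaré duals** (Bredon VI.11.10 for `tr ∘ cup`): if
`a ⌢ [X] ∈ im(H_l(A₁) → H_l(X(ℂ)))`, `b ⌢ [X] ∈ im(H_k(A₂) → H_k(X(ℂ)))` and `closure A₁ ∩ A₂ = ∅`, then `tr(a ∪ b) = 0`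
(the cup product `bettiCup hkl a b ∈ H²ⁿ`).
[cite: Bredon1993, Ch. VI Thm. 11.10] [cite: HatcherAT2002, §3.3 Thm. 3.26] -/
theorem tr_cup_eq_zero_of_disjoint_carriers (hX : IsSmoothProjective n X) {k l : ℕ} (hkl : k + l = 2 * n) (hlk : l + k = 2 * n)
    {A₁ A₂ : Set (ComplexPoints X)} (hd : Disjoint (closure A₁) A₂) (a : bettiCohomology X k) (b : bettiCohomology X l)
    (ha : poincareDualityMap (complexOrientationRat hX) hkl a ∈ LinearMap.range (singularHomology.map ℚ ℚ (subsetIncl A₁) l).hom)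
    (hb : poincareDualityMap (complexOrientationRat hX) hlk b ∈ LinearMap.range (singularHomology.map ℚ ℚ (subsetIncl A₂) k).hom) :
    tr hX (2 * n) (bettiCup hkl a b) = 0 := by
  letI := hX.chartedSpace
  haveI := Motives.ComplexPoints.compactSpace_of_isSmoothProjective hX
  haveI := Motives.ComplexPoints.t2Space_of_isSmoothProjective hX
  obtain ⟨c, hc⟩ := ha
  obtain ⟨d, hd'⟩ := hb
  -- carry `a ⌢ [X]` by the CLOSED set `closure A₁`
  have hfac : (subsetIncl (closure A₁)).comp (subsetInclusion (subset_closure : A₁ ⊆ closure A₁)) = subsetIncl A₁ := by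
    ext x; rfl
  have hσ : poincareDualityMap (complexOrientationRat hX) hkl a =
      singularHomology.map ℚ ℚ (subsetIncl (closure A₁)) l
        (singularHomology.map ℚ ℚ (subsetInclusion (subset_closure : A₁ ⊆ closure A₁)) l c) := by
    rw [← ModuleCat.comp_apply, ← singularHomology.map_comp, hfac]
    exact hc.symm
  have hF : IsClosed (range (subsetIncl (closure A₁))) := by
    rw [show range (subsetIncl (closure A₁)) = closure A₁ from Subtype.range_coe]; exact isClosed_closure
  have hFG : Disjoint (range (subsetIncl (closure A₁))) (range (subsetIncl A₂)) := by
    rwa [show range (subsetIncl (closure A₁)) = closure A₁ from Subtype.range_coe,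
      show range (subsetIncl A₂) = A₂ from Subtype.range_coe]
  have h0 : cupPairing (complexOrientationRat hX) hkl a b = 0 :=
    cupPairing_eq_zero_of_disjoint_carriers (complexOrientationRat hX) hkl hlk (subsetIncl (closure A₁)) hσ (subsetIncl A₂) hd'.symm
      hF hFG
  rw [cupPairing_apply] at h0
  have hcup : bettiCup hkl a b = 0 := eq_zero_of_kroneckerPairing_fundamentalClass_eq_zero hX _ h0
  rw [hcup, map_zero]

/-- **Surface case in the literal currency of the K1Q assembly** (`n = 4`, `2 + 2 = 4`, degree-`2` classes): the hypothesis `horth` of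
`monodromyBireflection_of_twoBallDatum` for two pieces with disjoint closures. [cite: Bredon1993, Ch. VI Thm. 11.10] -/
theorem tr_cup_eq_zero_of_disjoint_carriers_two (hX : IsSmoothProjective 2 X) {A₁ A₂ : Set (ComplexPoints X)}
    (hd : Disjoint (closure A₁) A₂) (a b : bettiCohomology X 2)
    (ha : poincareDualityMap (n := 4) (complexOrientationRat hX) (show 2 + 2 = 4 by norm_num) a ∈
      LinearMap.range (singularHomology.map ℚ ℚ (subsetIncl A₁) 2).hom)
    (hb : poincareDualityMap (n := 4) (complexOrientationRat hX) (show 2 + 2 = 4 by norm_num) b ∈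
      LinearMap.range (singularHomology.map ℚ ℚ (subsetIncl A₂) 2).hom) :
    tr hX (2 + 2) (cup X 2 2 a b) = 0 :=
  tr_cup_eq_zero_of_disjoint_carriers hX (k := 2) (l := 2) (by norm_num) (by norm_num) hd a b ha hb

end BettiUniverse

end Literature.AlgebraicGeometry.HodgeTheory

end
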